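import Summits.HodgeConjecture.HodgeConjecture.Theorems.Ring2WeilCoverageCMFieldRationalClassesDFourDyadic
import Summits.HodgeConjecture.HodgeConjecture.Theorems.Ring2WeilCoverageCMFieldAllPrimesW
import HarnessLib

/-!
# Ring 2 — Weil-family coverage, CM-field rows: THE PRIME ROWS OF THE NON-GALOIS TABLE `E = ℚ(√-(3+√2))` — `T(ℓ)`
  LISTED for every prime `ℓ` (WEIL-FAMILY-COVERAGE «## b03», cell (xxi¹⁰), part 56)

research route conditional on HC_CM; not a corollary; Q11.4-sentence-2 already refuted in dim ≥ 3.

Carrier `R = S² + 6S + 7` (`F = ℚ(√2)`, `θ = -3 ± √2`, `θθ' = 7`; rows labelled by `T(t) = {𝔭 : (t, θ)_𝔭 = -1}`)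
[cite: Deligne1982HodgeCycles, §4 (1), Cor. 4.2].  Parts V/W sorted the rational primes of this `D₄` table into three
kinds at CLASS level (split type `[ℓ] = [1]`, three type `[ℓ] = [3]`, private); parts 54/55 decided every PLACE of `T(ℓ)`.
This file writes the row `T(ℓ)` itself, for every prime `ℓ` (`v₂ = (√2)`, `𝔭_θ = (7, θ)`, `u_ℓ = (ℓ)` for `ℓ` inert in
`F`, `v, v'` the two places over a split `ℓ`):

* §162 INERT `ℓ ≡ ±3 (mod 8)`: `T(ℓ) ⊆ {v₂, 𝔭_θ, u_ℓ}` and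
  **`ℓ ≡ 3 (8)`, `(ℓ|7) = -1`: `T(ℓ) = {v₂, 𝔭_θ}` (= `T(3) = T(7)`, three type) · `ℓ ≡ 3 (8)`, `(ℓ|7) = 1`:
  `T(ℓ) = {v₂, u_ℓ}` · `ℓ ≡ 5 (8)`, `(ℓ|7) = -1`: `T(ℓ) = {u_ℓ, 𝔭_θ}` · `ℓ ≡ 5 (8)`, `(ℓ|7) = 1`: `T(ℓ) = ∅`.**
* §163 SPLIT `ℓ ≡ ±1 (mod 8)`, `ℓ ≠ 7`: `T(ℓ) ⊆ {v₂, 𝔭_θ, v, v'}` and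
  **`ℓ ≡ 1 (8)`, `(ℓ|7) = -1`: `T(ℓ) = {𝔭_θ, v}` for ONE place `v` over `ℓ` (lonely) · `ℓ ≡ 7 (8)`, `(ℓ|7) = 1`:
  `T(ℓ) = {v₂, v}` (lonely) · `ℓ ≡ 1 (8)`, `(ℓ|7) = 1`: `T(ℓ) = ∅` if `T⁴ + 6T² + 7` has a root mod `ℓ`, else `{v, v'}` ·
  `ℓ ≡ 7 (8)`, `(ℓ|7) = -1`: `T(ℓ) = {v₂, 𝔭_θ}` if a root, else `{v₂, 𝔭_θ, v, v'}` (`|T(ℓ)| = 4`).**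
So `|T(ℓ)| ∈ {0, 2, 4}`, and two distinct primes lie on the SAME row iff both are of split type or both of three type (every
other `T(ℓ)` contains a place over `ℓ`).  No new definition, no named fact, no sorry; nothing about the Hodge conjecture is asserted. -/

noncomputable section

set_option linter.dupNamespace false

open Polynomial NumberField IsDedekindDomain

namespace Summit.HodgeConjecture.HodgeConjecture.Ring2.WeilCoverageCM

open Literature.AlgebraicGeometry.Deligne1982
open Literature.AlgebraicGeometry.HodgeTheory (splitDiscriminantClassCM)
open Literature.NumberTheory.QuadraticForms

variable {R : Polynomial ℤ} [Fact (Irreducible (cmPolyQ R))] [Fact (Irreducible (realPolyQ R))]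

section DFourPrimeRows

/-! ### §162 Inert primes `ℓ ≡ ±3 (mod 8)`: `T(ℓ) ⊆ {v₂, 𝔭_θ, (ℓ)}` and the four rows -/

/-- `ℚ(√-(3+√2))`, `ℓ ≡ ±3 (mod 8)`: **the place `u_ℓ ∋ ℓ` is unique** (`8 = 2·2²` is a non-square mod `ℓ`, so `N u_ℓ = ℓ²`).
[folklore] -/
theorem dFour_place_unique_of_inert (hR : R = X ^ 2 + C 6 * X + C 7) {ℓ : ℕ} (hℓ : ℓ.Prime)
    (hin : ℓ % 8 = 3 ∨ ℓ % 8 = 5) (u₀ u : HeightOneSpectrum (𝓞 (realField R)))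
    (hℓu₀ : (ℓ : 𝓞 (realField R)) ∈ u₀.asIdeal) (hℓu : (ℓ : 𝓞 (realField R)) ∈ u.asIdeal) : u = u₀ := by
  haveI := Fact.mk hℓ
  have hℓ2 : ℓ ≠ 2 := by rintro rfl; omega
  obtain ⟨hRm, -⟩ := monic_and_natDegree_of_quadratic R hR
  obtain ⟨θₒ, hθ⟩ := exists_ringOfIntegers_coe_eq_root hRm
  have h20 : (2 : ZMod ℓ) ≠ 0 := by exact_mod_cast natCast_prime_ne_zero_zmod Nat.prime_two hℓ2
  have hn2 : ¬ IsSquare (2 : ZMod ℓ) := by rw [ZMod.exists_sq_eq_two_iff hℓ2]; omega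
  have hdisc : ¬ IsSquare (((6 : ℤ) ^ 2 - 4 * 7 : ℤ) : ZMod ℓ) := by
    have e : (((6 : ℤ) ^ 2 - 4 * 7 : ℤ) : ZMod ℓ) = 2 * 2 ^ 2 := by push_cast; norm_num
    rw [e, isSquare_mul_sq_iff_of_ne_zero h20]; exact hn2
  exact eq_of_natCast_mem_of_absNorm_eq_sq (finrank_realField_quadratic hR) hℓ u₀ u hℓu₀ hℓu
    (absNorm_eq_sq_of_not_isSquare_disc hR hθ hℓ hdisc u₀ hℓu₀)

/-- `ℚ(√-(3+√2))`, `ℓ ≡ ±3 (mod 8)`: **`T(ℓ) ⊆ {v₂, 𝔭_θ, u_ℓ}`** (part 55's shape of `T(ℓ) ∖ {v₂}` and the uniqueness of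
`u_ℓ`). [cite: Omeara1963, §63B Example 63:12] [cite: Deligne1982HodgeCycles, §4 (1)] -/
theorem dFour_badPlaces_natCast_subset_of_inert (hR : R = X ^ 2 + C 6 * X + C 7) {θₒ : 𝓞 (realField R)}
    (hθ : (θₒ : realField R) = AdjoinRoot.root (realPolyQ R)) (v₂ : HeightOneSpectrum (𝓞 (realField R)))
    (h2 : (2 : 𝓞 (realField R)) ∈ v₂.asIdeal) (w : HeightOneSpectrum (𝓞 (realField R)))
    (h7w : ((7 : ℕ) : 𝓞 (realField R)) ∈ w.asIdeal) (hθw : θₒ ∈ w.asIdeal) {ℓ : ℕ} (hℓ : ℓ.Prime)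
    (hin : ℓ % 8 = 3 ∨ ℓ % 8 = 5) (u₀ : HeightOneSpectrum (𝓞 (realField R))) (hℓu₀ : (ℓ : 𝓞 (realField R)) ∈ u₀.asIdeal) :
    badPlaces (ℓ : realField R) (AdjoinRoot.root (realPolyQ R)) ⊆ {Sum.inl v₂, Sum.inl w, Sum.inl u₀} := by
  intro x hx
  by_cases hxv : x = Sum.inl v₂
  · rw [hxv]; exact Set.mem_insert _ _
  · obtain ⟨u, rfl, -, -, hu⟩ := dFour_exists_of_mem_badPlaces_natCast_diff_dyadic hR hθ v₂ h2 w h7w hθw hℓ ⟨hx, hxv⟩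
    rcases hu with huw | ⟨-, hℓu⟩
    · rw [huw]; exact Set.mem_insert_of_mem _ (Set.mem_insert _ _)
    · rw [dFour_place_unique_of_inert hR hℓ hin u₀ u hℓu₀ hℓu]
      exact Set.mem_insert_of_mem _ (Set.mem_insert_of_mem _ (Set.mem_singleton _))

/-- `ℚ(√-(3+√2))`, `ℓ ≡ ±3 (mod 8)`: **`u_ℓ ∈ T(ℓ) ⟺ [(ℓ|7) = -1] XOR [ℓ ≡ 3 (mod 4)]`** (`(7|ℓ) = (-1)^{(ℓ-1)/2}(ℓ|7)`;
part 54's inert criterion `(7|ℓ) = -1`). [cite: Omeara1963, §63B Example 63:12] [cite: Deligne1982HodgeCycles, §4 (1)] -/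
theorem dFour_inl_mem_badPlaces_natCast_iff_xor_of_inert (hR : R = X ^ 2 + C 6 * X + C 7) {ℓ : ℕ} (hℓ : ℓ.Prime)
    (hin : ℓ % 8 = 3 ∨ ℓ % 8 = 5) (u₀ : HeightOneSpectrum (𝓞 (realField R))) (hℓu₀ : (ℓ : 𝓞 (realField R)) ∈ u₀.asIdeal) :
    Sum.inl u₀ ∈ badPlaces (ℓ : realField R) (AdjoinRoot.root (realPolyQ R)) ↔
      Xor (ℓ % 7 = 3 ∨ ℓ % 7 = 5 ∨ ℓ % 7 = 6) (ℓ % 4 = 3) := by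
  have hℓ2 : ℓ ≠ 2 := by rintro rfl; omega
  have hℓ7 : ℓ ≠ 7 := by rintro rfl; omega
  obtain ⟨hRm, -⟩ := monic_and_natDegree_of_quadratic R hR
  obtain ⟨θₒ, hθ⟩ := exists_ringOfIntegers_coe_eq_root hRm
  rw [dFour_inl_mem_badPlaces_natCast_iff_of_inert hR hθ hℓ hin u₀ hℓu₀]
  have key := xor_nonsquare_mod_seven_not_isSquare_seven_iff hℓ hℓ2 hℓ7
  generalize (ℓ % 7 = 3 ∨ ℓ % 7 = 5 ∨ ℓ % 7 = 6) = A at key ⊢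
  generalize (IsSquare (7 : ZMod ℓ)) = S at key ⊢
  generalize (ℓ % 4 = 3) = B at key ⊢
  unfold Xor at key ⊢
  tauto

/-- **`ℚ(√-(3+√2))`, `ℓ ≡ 3 (mod 8)`, `ℓ ≡ 3, 5, 6 (mod 7)`: `T(ℓ) = {v₂, 𝔭_θ}`** — the THREE-TYPE inert primes `3, 19, 59, 83,
131, …` all lie on the row of `3` and `7`. [cite: Omeara1963, §63B and §71D Thm. 71:18] [cite: Deligne1982HodgeCycles, §4 (1), Cor. 4.2] -/
theorem dFour_badPlaces_natCast_of_mod_eight_three_of_nonsquare (hR : R = X ^ 2 + C 6 * X + C 7)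
    {θₒ : 𝓞 (realField R)} (hθ : (θₒ : realField R) = AdjoinRoot.root (realPolyQ R)) (v₂ : HeightOneSpectrum (𝓞 (realField R)))
    (h2 : (2 : 𝓞 (realField R)) ∈ v₂.asIdeal) (w : HeightOneSpectrum (𝓞 (realField R))) (h7w : ((7 : ℕ) : 𝓞 (realField R)) ∈ w.asIdeal) (hθw : θₒ ∈ w.asIdeal)
    {ℓ : ℕ} (hℓ : ℓ.Prime) (h8 : ℓ % 8 = 3) (h7 : ℓ % 7 = 3 ∨ ℓ % 7 = 5 ∨ ℓ % 7 = 6) :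
    badPlaces (ℓ : realField R) (AdjoinRoot.root (realPolyQ R)) = {Sum.inl v₂, Sum.inl w} := by
  obtain ⟨u₀, hℓu₀⟩ := exists_place_natCast_mem (finrank_realField_quadratic hR) hℓ
  have hsub := dFour_badPlaces_natCast_subset_of_inert hR hθ v₂ h2 w h7w hθw hℓ (Or.inl h8) u₀ hℓu₀
  have hv₂ := (dFour_inl_mem_badPlaces_natCast_iff_of_mem_two hR v₂ h2 hℓ).2 (by omega)
  have hw := (dFour_inl_mem_badPlaces_natCast_iff_of_root_mem hR hθ w h7w hθw hℓ).2 (Or.inl h7)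
  have hu₀ : Sum.inl u₀ ∉ badPlaces (ℓ : realField R) (AdjoinRoot.root (realPolyQ R)) := by
    rw [dFour_inl_mem_badPlaces_natCast_iff_xor_of_inert hR hℓ (Or.inl h8) u₀ hℓu₀]
    exact fun h ↦ h.elim (fun h1 ↦ h1.2 (by omega)) fun h2 ↦ h2.2 h7
  refine Set.Subset.antisymm (fun x hx ↦ ?_) ?_
  · rcases hsub hx with h | h | h
    · rw [h]; exact Set.mem_insert _ _
    · rw [h]; exact Set.mem_insert_of_mem _ (Set.mem_singleton _)
    · rw [Set.mem_singleton_iff] at h; rw [h] at hx; exact absurd hx hu₀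
  · rintro x (rfl | rfl)
    · exact hv₂
    · exact hw

/-- **`ℚ(√-(3+√2))`, `ℓ ≡ 3 (mod 8)`, `ℓ ≡ 1, 2, 4 (mod 7)`: `T(ℓ) = {v₂, u_ℓ}`** (private inert primes `11, 43, 67, 107, …`;
each on its own row). [cite: Omeara1963, §63B and §71D Thm. 71:18] [cite: Deligne1982HodgeCycles, §4 (1) and Cor. 4.2] -/
theorem dFour_badPlaces_natCast_of_mod_eight_three_of_square (hR : R = X ^ 2 + C 6 * X + C 7)
    {θₒ : 𝓞 (realField R)} (hθ : (θₒ : realField R) = AdjoinRoot.root (realPolyQ R)) (v₂ : HeightOneSpectrum (𝓞 (realField R)))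
    (h2 : (2 : 𝓞 (realField R)) ∈ v₂.asIdeal) (w : HeightOneSpectrum (𝓞 (realField R))) (h7w : ((7 : ℕ) : 𝓞 (realField R)) ∈ w.asIdeal) (hθw : θₒ ∈ w.asIdeal)
    {ℓ : ℕ} (hℓ : ℓ.Prime) (h8 : ℓ % 8 = 3) (h7 : ℓ % 7 = 1 ∨ ℓ % 7 = 2 ∨ ℓ % 7 = 4)
    (u₀ : HeightOneSpectrum (𝓞 (realField R))) (hℓu₀ : (ℓ : 𝓞 (realField R)) ∈ u₀.asIdeal) :
    badPlaces (ℓ : realField R) (AdjoinRoot.root (realPolyQ R)) = {Sum.inl v₂, Sum.inl u₀} := by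
  have hsub := dFour_badPlaces_natCast_subset_of_inert hR hθ v₂ h2 w h7w hθw hℓ (Or.inl h8) u₀ hℓu₀
  have hv₂ := (dFour_inl_mem_badPlaces_natCast_iff_of_mem_two hR v₂ h2 hℓ).2 (by omega)
  have hw : Sum.inl w ∉ badPlaces (ℓ : realField R) (AdjoinRoot.root (realPolyQ R)) := by
    rw [dFour_inl_mem_badPlaces_natCast_iff_of_root_mem hR hθ w h7w hθw hℓ]; omega
  have hu₀ := (dFour_inl_mem_badPlaces_natCast_iff_xor_of_inert hR hℓ (Or.inl h8) u₀ hℓu₀).2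
    (Or.inr ⟨by omega, by omega⟩)
  refine Set.Subset.antisymm (fun x hx ↦ ?_) ?_
  · rcases hsub hx with h | h | h
    · rw [h]; exact Set.mem_insert _ _
    · rw [h] at hx; exact absurd hx hw
    · rw [Set.mem_singleton_iff] at h; rw [h]; exact Set.mem_insert_of_mem _ (Set.mem_singleton _)
  · rintro x (rfl | rfl)
    · exact hv₂
    · exact hu₀

/-- **`ℚ(√-(3+√2))`, `ℓ ≡ 5 (mod 8)`, `ℓ ≡ 3, 5, 6 (mod 7)`: `T(ℓ) = {u_ℓ, 𝔭_θ}`** (private inert primes `5, 13, 61, 101, …`;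
each on its own row). [cite: Omeara1963, §63B and §71D Thm. 71:18] [cite: Deligne1982HodgeCycles, §4 (1) and Cor. 4.2] -/
theorem dFour_badPlaces_natCast_of_mod_eight_five_of_nonsquare (hR : R = X ^ 2 + C 6 * X + C 7)
    {θₒ : 𝓞 (realField R)} (hθ : (θₒ : realField R) = AdjoinRoot.root (realPolyQ R)) (v₂ : HeightOneSpectrum (𝓞 (realField R)))
    (h2 : (2 : 𝓞 (realField R)) ∈ v₂.asIdeal) (w : HeightOneSpectrum (𝓞 (realField R))) (h7w : ((7 : ℕ) : 𝓞 (realField R)) ∈ w.asIdeal) (hθw : θₒ ∈ w.asIdeal)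
    {ℓ : ℕ} (hℓ : ℓ.Prime) (h8 : ℓ % 8 = 5) (h7 : ℓ % 7 = 3 ∨ ℓ % 7 = 5 ∨ ℓ % 7 = 6)
    (u₀ : HeightOneSpectrum (𝓞 (realField R))) (hℓu₀ : (ℓ : 𝓞 (realField R)) ∈ u₀.asIdeal) :
    badPlaces (ℓ : realField R) (AdjoinRoot.root (realPolyQ R)) = {Sum.inl u₀, Sum.inl w} := by
  have hsub := dFour_badPlaces_natCast_subset_of_inert hR hθ v₂ h2 w h7w hθw hℓ (Or.inr h8) u₀ hℓu₀
  have hv₂ : Sum.inl v₂ ∉ badPlaces (ℓ : realField R) (AdjoinRoot.root (realPolyQ R)) := by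
    rw [dFour_inl_mem_badPlaces_natCast_iff_of_mem_two hR v₂ h2 hℓ]; omega
  have hw := (dFour_inl_mem_badPlaces_natCast_iff_of_root_mem hR hθ w h7w hθw hℓ).2 (Or.inl h7)
  have hu₀ := (dFour_inl_mem_badPlaces_natCast_iff_xor_of_inert hR hℓ (Or.inr h8) u₀ hℓu₀).2 (Or.inl ⟨h7, by omega⟩)
  refine Set.Subset.antisymm (fun x hx ↦ ?_) ?_
  · rcases hsub hx with h | h | h
    · rw [h] at hx; exact absurd hx hv₂
    · rw [h]; exact Set.mem_insert_of_mem _ (Set.mem_singleton _)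
    · rw [Set.mem_singleton_iff] at h; rw [h]; exact Set.mem_insert _ _
  · rintro x (rfl | rfl)
    · exact hu₀
    · exact hw

/-- **`ℚ(√-(3+√2))`, `ℓ ≡ 5 (mod 8)`, `ℓ ≡ 1, 2, 4 (mod 7)`: `T(ℓ) = ∅`** (the split-type inert primes `29, 37, 53, 109, …`).
[cite: Omeara1963, §63B and §71D Thm. 71:18] [cite: Deligne1982HodgeCycles, §4 (1) and Cor. 4.2] -/
theorem dFour_badPlaces_natCast_of_mod_eight_five_of_square (hR : R = X ^ 2 + C 6 * X + C 7)
    {ℓ : ℕ} (hℓ : ℓ.Prime) (h8 : ℓ % 8 = 5) (h7 : ℓ % 7 = 1 ∨ ℓ % 7 = 2 ∨ ℓ % 7 = 4) :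
    badPlaces (ℓ : realField R) (AdjoinRoot.root (realPolyQ R)) = ∅ := by
  have h0 : (ℓ : realField R) ≠ 0 := by exact_mod_cast hℓ.ne_zero
  have h := (mk_eq_splitDiscriminantClassCM_iff_badPlaces_eq_empty (R := R) (Units.mk0 (ℓ : realField R) h0) even_two).1
    ((sqrtNegThreePlusSqrtTwo_mk_prime_eq_splitDiscriminantClassCM_iff hR ℓ hℓ _ (by rw [Units.val_mk0])).2
      (Or.inr (Or.inl ⟨h8, h7⟩)))
  rwa [Units.val_mk0] at h

/-! ### §163 Split primes `ℓ ≡ ±1 (mod 8)`, `ℓ ≠ 7`: `T(ℓ) ⊆ {v₂, 𝔭_θ, v, v'}` and the four rows -/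

/-- `ℚ(√-(3+√2))`, `ℓ` split in `F` with places `v, v'` exhausting the fibre: **`T(ℓ) ⊆ {v₂, 𝔭_θ, v, v'}`**.
[cite: Omeara1963, §63B Example 63:12] [cite: Deligne1982HodgeCycles, §4 (1)] -/
theorem dFour_badPlaces_natCast_subset_of_split (hR : R = X ^ 2 + C 6 * X + C 7) {θₒ : 𝓞 (realField R)}
    (hθ : (θₒ : realField R) = AdjoinRoot.root (realPolyQ R)) (v₂ : HeightOneSpectrum (𝓞 (realField R)))
    (h2 : (2 : 𝓞 (realField R)) ∈ v₂.asIdeal) (w : HeightOneSpectrum (𝓞 (realField R)))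
    (h7w : ((7 : ℕ) : 𝓞 (realField R)) ∈ w.asIdeal) (hθw : θₒ ∈ w.asIdeal) {ℓ : ℕ} (hℓ : ℓ.Prime)
    (v v' : HeightOneSpectrum (𝓞 (realField R)))
    (hall : ∀ u : HeightOneSpectrum (𝓞 (realField R)), (ℓ : 𝓞 (realField R)) ∈ u.asIdeal → u = v ∨ u = v') :
    badPlaces (ℓ : realField R) (AdjoinRoot.root (realPolyQ R)) ⊆ {Sum.inl v₂, Sum.inl w, Sum.inl v, Sum.inl v'} := by
  intro x hx
  by_cases hxv : x = Sum.inl v₂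
  · rw [hxv]; exact Set.mem_insert _ _
  · obtain ⟨u, rfl, -, -, hu⟩ := dFour_exists_of_mem_badPlaces_natCast_diff_dyadic hR hθ v₂ h2 w h7w hθw hℓ ⟨hx, hxv⟩
    rcases hu with huw | ⟨-, hℓu⟩
    · rw [huw]; exact Set.mem_insert_of_mem _ (Set.mem_insert _ _)
    · rcases hall u hℓu with huv | huv'
      · rw [huv]; exact Set.mem_insert_of_mem _ (Set.mem_insert_of_mem _ (Set.mem_insert _ _))
      · rw [huv']
        exact Set.mem_insert_of_mem _ (Set.mem_insert_of_mem _ (Set.mem_insert_of_mem _ (Set.mem_singleton _)))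

/-- `ℚ(√-(3+√2))`, `ℓ` split in `F`, `ℓ ≠ 7`, `(7|ℓ) = -1`: **exactly one of the two places over `ℓ` is bad** — the bad
one `v₁` and the good one `v₀` (part 54's lonely primes, packaged). [cite: Omeara1963, §63B Cor. 63:11a] [cite: Deligne1982HodgeCycles, §4 (1)] -/
theorem dFour_exists_lonely_pair (hR : R = X ^ 2 + C 6 * X + C 7) {θₒ : 𝓞 (realField R)}
    (hθ : (θₒ : realField R) = AdjoinRoot.root (realPolyQ R)) {ℓ : ℕ} (hℓ : ℓ.Prime) (hsp : ℓ % 8 = 1 ∨ ℓ % 8 = 7)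
    (hℓ7 : ℓ ≠ 7) (hn7 : ¬ IsSquare (7 : ZMod ℓ)) :
    ∃ v₁ v₀ : HeightOneSpectrum (𝓞 (realField R)), v₁ ≠ v₀ ∧ (ℓ : 𝓞 (realField R)) ∈ v₁.asIdeal ∧
      (ℓ : 𝓞 (realField R)) ∈ v₀.asIdeal ∧
      (∀ u : HeightOneSpectrum (𝓞 (realField R)), (ℓ : 𝓞 (realField R)) ∈ u.asIdeal → u = v₁ ∨ u = v₀) ∧
      Sum.inl v₁ ∈ badPlaces (ℓ : realField R) (AdjoinRoot.root (realPolyQ R)) ∧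
      Sum.inl v₀ ∉ badPlaces (ℓ : realField R) (AdjoinRoot.root (realPolyQ R)) := by
  obtain ⟨v, v', hvv', hℓv, hℓv', hall, hfib⟩ := dFour_fibre_iff_isSquare_seven hR hθ hℓ hsp hℓ7
  by_cases hv : Sum.inl v ∈ badPlaces (ℓ : realField R) (AdjoinRoot.root (realPolyQ R))
  · exact ⟨v, v', hvv', hℓv, hℓv', hall, hv, fun hv' ↦ hn7 (hfib.1 (iff_of_true hv hv'))⟩
  · refine ⟨v', v, hvv'.symm, hℓv', hℓv, fun u hu ↦ (hall u hu).symm, ?_, hv⟩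
    by_contra hv'
    exact hn7 (hfib.1 (iff_of_false hv hv'))

/-- **`ℚ(√-(3+√2))`, `ℓ ≡ 1 (mod 8)`, `ℓ ≡ 3, 5, 6 (mod 7)` (LONELY, `(7|ℓ) = -1`): `T(ℓ) = {𝔭_θ, v}` for exactly one of the
two places over `ℓ`** (`17, 41, 73, 89, 97, …`). [cite: Omeara1963, §63B Cor. 63:11a, §71D Thm. 71:18] [cite: Deligne1982HodgeCycles, §4 (1)] -/
theorem dFour_badPlaces_natCast_of_mod_eight_one_of_nonsquare (hR : R = X ^ 2 + C 6 * X + C 7)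
    {θₒ : 𝓞 (realField R)} (hθ : (θₒ : realField R) = AdjoinRoot.root (realPolyQ R)) (v₂ : HeightOneSpectrum (𝓞 (realField R)))
    (h2 : (2 : 𝓞 (realField R)) ∈ v₂.asIdeal) (w : HeightOneSpectrum (𝓞 (realField R))) (h7w : ((7 : ℕ) : 𝓞 (realField R)) ∈ w.asIdeal) (hθw : θₒ ∈ w.asIdeal)
    {ℓ : ℕ} (hℓ : ℓ.Prime) (h8 : ℓ % 8 = 1) (h7 : ℓ % 7 = 3 ∨ ℓ % 7 = 5 ∨ ℓ % 7 = 6) :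
    ∃ v v' : HeightOneSpectrum (𝓞 (realField R)), v ≠ v' ∧ (ℓ : 𝓞 (realField R)) ∈ v.asIdeal ∧
      (ℓ : 𝓞 (realField R)) ∈ v'.asIdeal ∧
      badPlaces (ℓ : realField R) (AdjoinRoot.root (realPolyQ R)) = {Sum.inl w, Sum.inl v} := by
  have hℓ2 : ℓ ≠ 2 := by rintro rfl; omega
  have hℓ7 : ℓ ≠ 7 := by rintro rfl; omega
  have hn7 : ¬ IsSquare (7 : ZMod ℓ) := by rw [isSquare_seven_iff hℓ hℓ2 hℓ7]; omega
  have hv₂ : Sum.inl v₂ ∉ badPlaces (ℓ : realField R) (AdjoinRoot.root (realPolyQ R)) := by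
    rw [dFour_inl_mem_badPlaces_natCast_iff_of_mem_two hR v₂ h2 hℓ]; omega
  have hw := (dFour_inl_mem_badPlaces_natCast_iff_of_root_mem hR hθ w h7w hθw hℓ).2 (Or.inl h7)
  obtain ⟨v₁, v₀, h10, hℓv₁, hℓv₀, hall', hv₁, hv₀⟩ := dFour_exists_lonely_pair hR hθ hℓ (Or.inl h8) hℓ7 hn7
  refine ⟨v₁, v₀, h10, hℓv₁, hℓv₀, Set.Subset.antisymm (fun x hx ↦ ?_) ?_⟩
  · rcases dFour_badPlaces_natCast_subset_of_split hR hθ v₂ h2 w h7w hθw hℓ v₁ v₀ hall' hx with h | h | h | h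
    · rw [h] at hx; exact absurd hx hv₂
    · rw [h]; exact Set.mem_insert _ _
    · rw [h]; exact Set.mem_insert_of_mem _ (Set.mem_singleton _)
    · rw [Set.mem_singleton_iff] at h; rw [h] at hx; exact absurd hx hv₀
  · rintro x (rfl | rfl)
    · exact hw
    · exact hv₁

/-- **`ℚ(√-(3+√2))`, `ℓ ≡ 7 (mod 8)`, `ℓ ≠ 7`, `ℓ ≡ 1, 2, 4 (mod 7)` (LONELY, `(7|ℓ) = -1`): `T(ℓ) = {v₂, v}` for exactly one
of the two places over `ℓ`** (`23, 71, 79, 127, 151, …`). [cite: Omeara1963, §63B Cor. 63:11a, §71D Thm. 71:18] [cite: Deligne1982HodgeCycles, §4 (1)] -/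
theorem dFour_badPlaces_natCast_of_mod_eight_seven_of_square (hR : R = X ^ 2 + C 6 * X + C 7)
    {θₒ : 𝓞 (realField R)} (hθ : (θₒ : realField R) = AdjoinRoot.root (realPolyQ R)) (v₂ : HeightOneSpectrum (𝓞 (realField R)))
    (h2 : (2 : 𝓞 (realField R)) ∈ v₂.asIdeal) (w : HeightOneSpectrum (𝓞 (realField R))) (h7w : ((7 : ℕ) : 𝓞 (realField R)) ∈ w.asIdeal) (hθw : θₒ ∈ w.asIdeal)
    {ℓ : ℕ} (hℓ : ℓ.Prime) (h8 : ℓ % 8 = 7) (h7 : ℓ % 7 = 1 ∨ ℓ % 7 = 2 ∨ ℓ % 7 = 4) :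
    ∃ v v' : HeightOneSpectrum (𝓞 (realField R)), v ≠ v' ∧ (ℓ : 𝓞 (realField R)) ∈ v.asIdeal ∧
      (ℓ : 𝓞 (realField R)) ∈ v'.asIdeal ∧
      badPlaces (ℓ : realField R) (AdjoinRoot.root (realPolyQ R)) = {Sum.inl v₂, Sum.inl v} := by
  have hℓ2 : ℓ ≠ 2 := by rintro rfl; omega
  have hℓ7 : ℓ ≠ 7 := by rintro rfl; omega
  have hn7 : ¬ IsSquare (7 : ZMod ℓ) := by rw [isSquare_seven_iff hℓ hℓ2 hℓ7]; omega
  have hv₂ := (dFour_inl_mem_badPlaces_natCast_iff_of_mem_two hR v₂ h2 hℓ).2 (by omega)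
  have hw : Sum.inl w ∉ badPlaces (ℓ : realField R) (AdjoinRoot.root (realPolyQ R)) := by
    rw [dFour_inl_mem_badPlaces_natCast_iff_of_root_mem hR hθ w h7w hθw hℓ]; omega
  obtain ⟨v₁, v₀, h10, hℓv₁, hℓv₀, hall', hv₁, hv₀⟩ := dFour_exists_lonely_pair hR hθ hℓ (Or.inr h8) hℓ7 hn7
  refine ⟨v₁, v₀, h10, hℓv₁, hℓv₀, Set.Subset.antisymm (fun x hx ↦ ?_) ?_⟩
  · rcases dFour_badPlaces_natCast_subset_of_split hR hθ v₂ h2 w h7w hθw hℓ v₁ v₀ hall' hx with h | h | h | h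
    · rw [h]; exact Set.mem_insert _ _
    · rw [h] at hx; exact absurd hx hw
    · rw [h]; exact Set.mem_insert_of_mem _ (Set.mem_singleton _)
    · rw [Set.mem_singleton_iff] at h; rw [h] at hx; exact absurd hx hv₀
  · rintro x (rfl | rfl)
    · exact hv₂
    · exact hv₁

/-- **`ℚ(√-(3+√2))`, `ℓ ≡ 1 (mod 8)`, `ℓ ≡ 1, 2, 4 (mod 7)` (`(7|ℓ) = 1`): `T(ℓ) = ∅` if `T⁴ + 6T² + 7` has a root mod `ℓ`
(split type: `137, 193, …`), and `T(ℓ) = {v, v'}` — BOTH places over `ℓ` — if not (`113, 233, 281, …`).**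
[cite: Omeara1963, §63B Cor. 63:11a and §71D Thm. 71:18] [cite: Deligne1982HodgeCycles, §4 (1) and Cor. 4.2] -/
theorem dFour_badPlaces_natCast_of_mod_eight_one_of_square (hR : R = X ^ 2 + C 6 * X + C 7)
    {θₒ : 𝓞 (realField R)} (hθ : (θₒ : realField R) = AdjoinRoot.root (realPolyQ R))
    {ℓ : ℕ} (hℓ : ℓ.Prime) (h8 : ℓ % 8 = 1) (h7 : ℓ % 7 = 1 ∨ ℓ % 7 = 2 ∨ ℓ % 7 = 4) :
    ((∃ e : ZMod ℓ, e ^ 4 + 6 * e ^ 2 + 7 = 0) → badPlaces (ℓ : realField R) (AdjoinRoot.root (realPolyQ R)) = ∅) ∧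
    (¬ (∃ e : ZMod ℓ, e ^ 4 + 6 * e ^ 2 + 7 = 0) → ∃ v v' : HeightOneSpectrum (𝓞 (realField R)), v ≠ v' ∧
      (ℓ : 𝓞 (realField R)) ∈ v.asIdeal ∧ (ℓ : 𝓞 (realField R)) ∈ v'.asIdeal ∧
      badPlaces (ℓ : realField R) (AdjoinRoot.root (realPolyQ R)) = {Sum.inl v, Sum.inl v'}) := by
  have hℓ2 : ℓ ≠ 2 := by rintro rfl; omega
  have hℓ7 : ℓ ≠ 7 := by rintro rfl; omega
  have h85 : ℓ % 8 ≠ 5 := by omega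
  have h4 : ℓ % 4 ≠ 3 := by omega
  have h7n : ¬ ((ℓ % 7 = 3 ∨ ℓ % 7 = 5 ∨ ℓ % 7 = 6) ∨ ℓ = 7) := by omega
  have hy7 : IsSquare (7 : ZMod ℓ) := by rw [isSquare_seven_iff hℓ hℓ2 hℓ7]; omega
  have h0 : (ℓ : realField R) ≠ 0 := by exact_mod_cast hℓ.ne_zero
  have hclass := sqrtNegThreePlusSqrtTwo_mk_prime_eq_splitDiscriminantClassCM_iff hR ℓ hℓ
    (Units.mk0 (ℓ : realField R) h0) (by rw [Units.val_mk0])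
  have hempty := mk_eq_splitDiscriminantClassCM_iff_badPlaces_eq_empty (R := R) (Units.mk0 (ℓ : realField R) h0) even_two
  rw [Units.val_mk0] at hempty
  refine ⟨fun hroot ↦ hempty.1 (hclass.2 (Or.inr (Or.inr ⟨h8, h7, hroot⟩))), fun hroot ↦ ?_⟩
  have hne : badPlaces (ℓ : realField R) (AdjoinRoot.root (realPolyQ R)) ≠ ∅ := fun h ↦ by
    rcases hclass.1 (hempty.2 h) with h2' | ⟨h8', -⟩ | ⟨-, -, hr⟩
    · exact hℓ2 h2'
    · exact h85 h8'
    · exact hroot hr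
  have hK := finrank_realField_quadratic hR
  obtain ⟨w, w', -, h7w, -, hθw, -, -, -, -, -, -⟩ := dFour_places_over_seven hR hθ
  obtain ⟨v₂, h2⟩ := exists_place_natCast_mem hK Nat.prime_two
  have h2' : (2 : 𝓞 (realField R)) ∈ v₂.asIdeal := by exact_mod_cast h2
  obtain ⟨v, v', hvv', hℓv, hℓv', hall, hfib⟩ := dFour_fibre_iff_isSquare_seven hR hθ hℓ (Or.inl h8) hℓ7
  have hv₂ : Sum.inl v₂ ∉ badPlaces (ℓ : realField R) (AdjoinRoot.root (realPolyQ R)) := fun h ↦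
    h4 ((dFour_inl_mem_badPlaces_natCast_iff_of_mem_two hR v₂ h2' hℓ).1 h)
  have hw : Sum.inl w ∉ badPlaces (ℓ : realField R) (AdjoinRoot.root (realPolyQ R)) := fun h ↦
    h7n ((dFour_inl_mem_badPlaces_natCast_iff_of_root_mem hR hθ w h7w hθw hℓ).1 h)
  have hsub := dFour_badPlaces_natCast_subset_of_split hR hθ v₂ h2' w h7w hθw hℓ v v' hall
  -- some place is bad; it is `v` or `v'`, and then both are
  obtain ⟨x, hx⟩ := Set.nonempty_iff_ne_empty.2 hne
  have hboth : Sum.inl v ∈ badPlaces (ℓ : realField R) (AdjoinRoot.root (realPolyQ R)) ∧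
      Sum.inl v' ∈ badPlaces (ℓ : realField R) (AdjoinRoot.root (realPolyQ R)) := by
    rcases hsub hx with h | h | h | h
    · rw [h] at hx; exact absurd hx hv₂
    · rw [h] at hx; exact absurd hx hw
    · rw [h] at hx; exact ⟨hx, (hfib.2 hy7).1 hx⟩
    · rw [Set.mem_singleton_iff] at h; rw [h] at hx; exact ⟨(hfib.2 hy7).2 hx, hx⟩
  refine ⟨v, v', hvv', hℓv, hℓv', Set.Subset.antisymm (fun y hy ↦ ?_) ?_⟩
  · rcases hsub hy with h | h | h | h
    · rw [h] at hy; exact absurd hy hv₂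
    · rw [h] at hy; exact absurd hy hw
    · rw [h]; exact Set.mem_insert _ _
    · rw [Set.mem_singleton_iff] at h; rw [h]; exact Set.mem_insert_of_mem _ (Set.mem_singleton _)
  · rintro y (rfl | rfl)
    · exact hboth.1
    · exact hboth.2

/-- **`ℚ(√-(3+√2))`, `ℓ ≡ 7 (mod 8)`, `ℓ ≡ 3, 5, 6 (mod 7)` (`(7|ℓ) = 1`): `T(ℓ) = {v₂, 𝔭_θ}` (= `T(3)`, three type: `31, 47,
311, …`) if `T⁴ + 6T² + 7` has a root mod `ℓ`, else `T(ℓ) = {v₂, 𝔭_θ, v, v'}` — a row with FOUR places (`103, 167, 199, …`)**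
(`T(3ℓ) = T(3) ∆ T(ℓ) = T(ℓ) ∖ {v₂, 𝔭_θ}` is empty iff `[3ℓ] = [1]` iff three type, parts V/W).
[cite: Omeara1963, §63B Cor. 63:11a and §71D Thm. 71:18] [cite: Deligne1982HodgeCycles, §4 (1) and Cor. 4.2] -/
theorem dFour_badPlaces_natCast_of_mod_eight_seven_of_nonsquare (hR : R = X ^ 2 + C 6 * X + C 7)
    {θₒ : 𝓞 (realField R)} (hθ : (θₒ : realField R) = AdjoinRoot.root (realPolyQ R)) (v₂ : HeightOneSpectrum (𝓞 (realField R)))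
    (h2 : (2 : 𝓞 (realField R)) ∈ v₂.asIdeal) (w : HeightOneSpectrum (𝓞 (realField R))) (h7w : ((7 : ℕ) : 𝓞 (realField R)) ∈ w.asIdeal) (hθw : θₒ ∈ w.asIdeal)
    {ℓ : ℕ} (hℓ : ℓ.Prime) (h8 : ℓ % 8 = 7) (h7 : ℓ % 7 = 3 ∨ ℓ % 7 = 5 ∨ ℓ % 7 = 6) :
    ((∃ e : ZMod ℓ, e ^ 4 + 6 * e ^ 2 + 7 = 0) →
      badPlaces (ℓ : realField R) (AdjoinRoot.root (realPolyQ R)) = {Sum.inl v₂, Sum.inl w}) ∧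
    (¬ (∃ e : ZMod ℓ, e ^ 4 + 6 * e ^ 2 + 7 = 0) → ∃ v v' : HeightOneSpectrum (𝓞 (realField R)), v ≠ v' ∧
      (ℓ : 𝓞 (realField R)) ∈ v.asIdeal ∧ (ℓ : 𝓞 (realField R)) ∈ v'.asIdeal ∧
      badPlaces (ℓ : realField R) (AdjoinRoot.root (realPolyQ R)) = {Sum.inl v₂, Sum.inl w, Sum.inl v, Sum.inl v'}) := by
  have hℓ2 : ℓ ≠ 2 := by rintro rfl; omega
  have hℓ7 : ℓ ≠ 7 := by rintro rfl; omega
  have hℓ3 : ℓ ≠ 3 := by rintro rfl; omega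
  have h4 : ℓ % 4 = 3 := by omega
  have hy7 : IsSquare (7 : ZMod ℓ) := by rw [isSquare_seven_iff hℓ hℓ2 hℓ7]; omega
  have hnS : ¬ (ℓ = 2 ∨ (ℓ % 8 = 5 ∧ (ℓ % 7 = 1 ∨ ℓ % 7 = 2 ∨ ℓ % 7 = 4)) ∨
      (ℓ % 8 = 1 ∧ (ℓ % 7 = 1 ∨ ℓ % 7 = 2 ∨ ℓ % 7 = 4) ∧ ∃ e : ZMod ℓ, e ^ 4 + 6 * e ^ 2 + 7 = 0)) := by
    rintro (h | ⟨h, -⟩ | ⟨h, -, -⟩) <;> omega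
  have hnT3 : ¬ (ℓ % 8 = 3 ∧ (ℓ % 7 = 3 ∨ ℓ % 7 = 5 ∨ ℓ % 7 = 6)) := fun h ↦ by omega
  have h3dvd : ¬ (ℓ : ℤ) ∣ (3 : ℤ) := fun h ↦
    hℓ3 ((Nat.prime_dvd_prime_iff_eq hℓ Nat.prime_three).1 (by exact_mod_cast h))
  have h0 : (ℓ : realField R) ≠ 0 := by exact_mod_cast hℓ.ne_zero
  have h3ℓ0 : (3 * ℓ : realField R) ≠ 0 := mul_ne_zero (by norm_num) h0
  -- `T(3) = {v₂, 𝔭_θ}` and `T(3ℓ) = T(3) ∆ T(ℓ)`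
  have hT3 := dFour_badPlaces_natCast_of_mod_eight_three_of_nonsquare hR hθ v₂ h2 w h7w hθw Nat.prime_three
    (by norm_num) (by norm_num)
  have hmul : badPlaces (3 * ℓ : realField R) (AdjoinRoot.root (realPolyQ R)) =
      symmDiff {Sum.inl v₂, Sum.inl w} (badPlaces (ℓ : realField R) (AdjoinRoot.root (realPolyQ R))) := by
    rw [← hT3, Nat.cast_ofNat]; exact badPlaces_mul (by norm_num) h0 root_realPolyQ_ne_zero
  -- `T(3ℓ) = ∅ ⟺ [3ℓ] = [1]`
  have hempty := mk_eq_splitDiscriminantClassCM_iff_badPlaces_eq_empty (R := R) (Units.mk0 (3 * ℓ : realField R) h3ℓ0)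
    even_two
  rw [Units.val_mk0, hmul, Set.symmDiff_eq_empty] at hempty
  have hv₂ := (dFour_inl_mem_badPlaces_natCast_iff_of_mem_two hR v₂ h2 hℓ).2 h4
  have hw := (dFour_inl_mem_badPlaces_natCast_iff_of_root_mem hR hθ w h7w hθw hℓ).2 (Or.inl h7)
  refine ⟨fun hroot ↦ (hempty.1 (sqrtNegThreePlusSqrtTwo_threeType_class hR ℓ hℓ (Or.inr (Or.inr ⟨h8, h7, hroot⟩)) _
    (by rw [Units.val_mk0]))).symm, fun hroot ↦ ?_⟩
  -- private prime: `[3ℓ] ≠ [1]`, so `T(ℓ) ≠ {v₂, 𝔭_θ}`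
  have hnT : ¬ (ℓ = 7 ∨ (ℓ % 8 = 3 ∧ (ℓ % 7 = 3 ∨ ℓ % 7 = 5 ∨ ℓ % 7 = 6)) ∨
      (ℓ % 8 = 7 ∧ (ℓ % 7 = 3 ∨ ℓ % 7 = 5 ∨ ℓ % 7 = 6) ∧ ∃ e : ZMod ℓ, e ^ 4 + 6 * e ^ 2 + 7 = 0)) :=
    fun h ↦ h.elim hℓ7 fun h ↦ h.elim hnT3 fun h ↦ hroot h.2.2
  have hpriv := sqrtNegThreePlusSqrtTwo_private_obstruction hR ℓ hℓ hnS hnT (3 : ℤ) h3dvd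
    (Units.mk0 (3 * ℓ : realField R) h3ℓ0)
    (by simp only [Units.val_mk0, map_mul, map_natCast, map_ofNat, Int.cast_ofNat, mul_comm])
  have hne : badPlaces (ℓ : realField R) (AdjoinRoot.root (realPolyQ R)) ≠ {Sum.inl v₂, Sum.inl w} :=
    fun h ↦ hpriv (hempty.2 h.symm)
  obtain ⟨v, v', hvv', hℓv, hℓv', hall, hfib⟩ := dFour_fibre_iff_isSquare_seven hR hθ hℓ (Or.inr h8) hℓ7
  have hsub := dFour_badPlaces_natCast_subset_of_split hR hθ v₂ h2 w h7w hθw hℓ v v' hall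
  -- a bad place outside `{v₂, 𝔭_θ}` exists: it is `v` or `v'`, hence both
  have hboth : Sum.inl v ∈ badPlaces (ℓ : realField R) (AdjoinRoot.root (realPolyQ R)) ∧
      Sum.inl v' ∈ badPlaces (ℓ : realField R) (AdjoinRoot.root (realPolyQ R)) := by
    by_contra hnot
    apply hne
    refine Set.Subset.antisymm (fun x hx ↦ ?_) ?_
    · rcases hsub hx with h | h | h | h
      · rw [h]; exact Set.mem_insert _ _
      · rw [h]; exact Set.mem_insert_of_mem _ (Set.mem_singleton _)
      · rw [h] at hx; exact absurd ⟨hx, (hfib.2 hy7).1 hx⟩ hnot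
      · rw [Set.mem_singleton_iff] at h; rw [h] at hx; exact absurd ⟨(hfib.2 hy7).2 hx, hx⟩ hnot
    · rintro x (rfl | rfl)
      · exact hv₂
      · exact hw
  refine ⟨v, v', hvv', hℓv, hℓv', Set.Subset.antisymm (fun y hy ↦ hsub hy) ?_⟩
  rintro y (rfl | rfl | rfl | rfl)
  · exact hv₂
  · exact hw
  · exact hboth.1
  · exact hboth.2

end DFourPrimeRows

end Summit.HodgeConjecture.HodgeConjecture.Ring2.WeilCoverageCM

end
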